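import Literature.Probability.RandomPlanarGeometry.BDGS2012CountMonoExt
import Literature.Probability.RandomPlanarGeometry.UniformSAWCurveLaw
import HarnessLib

/-!
# Monotonicity `cₙ ≤ cₙ₊₁` (O'Brien 1990): time reversal, the two-ended extension identity, and the
# reduction to doubly trapped walks

Sibling of `BDGS2012CountMonoExt.lean` (extension identity `cₙ₊₁ = Σ_ω extCount ω n`, trapped-walk
criteria) for the named fact `BDGS2012_count_mono` (O'Brien, *Monotonicity of the number of
self-avoiding walks*, J. Stat. Phys. **59** (1990) 969–979; quoted in BDGS 2012 §1.3 and in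
Madras–Slade §7.1 p. 231).

An `n`-step self-avoiding walk `ω` can be prolonged at its END by `extCount ω n` free sites and at its
START by `extCount (revWalk n ω) n` free sites, where `revWalk n ω` is the tree's time-reversed and
recentred walk `i ↦ ω n - ω (n - i)` (`UniformSAWCurveLaw.lean`: again an `n`-step self-avoiding walk
from `0`, and `revWalk n` is an involution of `saws d n`). Every `(n+1)`-step walk arises exactly once as an end-prolongation and exactly once as a
start-prolongation, so

* `two_mul_count_succ_eq_sum` : `2 cₙ₊₁ = Σ_{ω ∈ saws d n} (extCount ω n + extCount (revWalk n ω) n)`.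

Pairing every END-TRAPPED walk (`extCount ω n = 0`) whose START still has at least two free
neighbours with its reversal (an untrapped walk with at least two free end-extensions) pays the
deficit of all such walks in the extension identity; what is left are the **doubly trapped** walks
`T₂ = {ω : extCount ω n = 0 ∧ extCount (revWalk n ω) n ≤ 1}` (trapped at the end, at most one free
neighbour at the start):

* `count_le_count_succ_add_card_doublyTrapped` : **`cₙ ≤ cₙ₊₁ + #T₂`** (unconditional, all `d`, `n`);
* `count_le_count_succ_of_doublyTrapped_injOn` : O'Brien's inequality `cₙ ≤ cₙ₊₁` follows from any
  injection of `T₂` into the `n`-step walks `ω'` with `extCount ω' n ≥ 3`, or with `extCount ω' n ≥ 2`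
  and a start that is not completely surrounded (`extCount (revWalk n ω') n ≥ 1`);
* `count_le_count_succ_of_doublyTrapped_fibers` : the same with bounded fibres instead of an
  injection (a walk `ω'` may receive up to `extCount ω' n - 2` doubly trapped walks, or up to
  `extCount ω' n - 1` when its start is not completely surrounded); both are instances of the
  weighted lemma `card_not_doublyTrapped_add_sum_le_count_succ`.

These reduce the named fact to a statement about the (rare) walks that are enclosed at both ends:
on `ℤ²` there are no doubly trapped walks of length `n ≤ 8`, and `8, 8, 80` of them for
`n = 9, 10, 11` against `cₙ = 16268, 44100, 120292` (exact enumeration, lane «pcv-sawmu» a-p4 g24,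
not used in any proof). The reversal symmetry and the extension identity are textbook
(Madras–Slade §1.1); the pairing bookkeeping is elementary and written here for the lane's O'Brien
programme; no named facts are introduced. [cite: MadrasSlade1993, §1.1, eq. (1.1.1); §7.1 p. 231]
[cite: BDGS2012, §1.3]
-/

noncomputable section

open Literature.Probability.LatticeModels Literature.Probability.Percolation SimpleGraph
open scoped BigOperators

namespace Literature.Probability.RandomPlanarGeometry.SAW.Zd

variable {d : ℕ}

/-! ### Time reversal (the tree's `revWalk`, `UniformSAWCurveLaw.lean`) -/

/-- Reversal is injective on `saws d n`. [cite: MadrasSlade1993, §1.1] -/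
theorem revWalk_injOn (n : ℕ) : Set.InjOn (revWalk (d := d) n) (saws d n : Set (ℕ → Site d)) :=
  (bijOn_revWalk d n).injOn

/-- Reversal maps `saws d n` onto itself (finset form). [cite: MadrasSlade1993, §1.1] -/
theorem image_revWalk_saws (d n : ℕ) [DecidableEq (ℕ → Site d)] :
    (saws d n).image (revWalk n) = saws d n := by
  ext ω
  simp only [Finset.mem_image]
  constructor
  · rintro ⟨ω', hω', rfl⟩; exact revWalk_mem_saws hω'
  · intro hω; exact ⟨revWalk n ω, revWalk_mem_saws hω, revWalk_revWalk hω⟩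

/-! ### Free sites at the start: `extCount (revWalk n ω) n` -/

/-- The free extensions of the reversed walk correspond to the free neighbours of the START of `ω`:
`y` prolongs `revWalk n ω` iff `ω n - y` is a neighbour of `ω 0 = 0` not visited during `[0, n]`
(so `extCount (revWalk n ω) n` is the number of one-step prolongations of `ω` at its start).
[cite: MadrasSlade1993, §1.1] -/
theorem mem_freeNbrs_revWalk {n : ℕ} {ω : ℕ → Site d} (hω : ω ∈ saws d n) {y : Site d} :
    y ∈ freeNbrs (revWalk n ω) n ↔
      (zdGraph d).Adj (ω 0) (ω n - y) ∧ ∀ i ≤ n, ω i ≠ ω n - y := by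
  obtain ⟨h0, -, -, -⟩ := mem_saws.1 hω
  have hn : revWalk n ω n = ω n := by simp [revWalk, h0]
  have hi : ∀ i ≤ n, revWalk n ω (n - i) = ω n - ω i := fun i hi => by
    simp [revWalk, Nat.sub_sub_self hi]
  have hadj : (zdGraph d).Adj (ω n) y ↔ (zdGraph d).Adj (ω 0) (ω n - y) := by
    rw [h0, ← zdGraph_adj_sub_right (ω n) y (ω n), sub_self, ← zdGraph_adj_neg, neg_zero, neg_sub]
  rw [mem_freeNbrs, hn, hadj]
  refine and_congr_right fun _ => ⟨fun h i hi' e => ?_, fun h i hi' e => ?_⟩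
  · exact h (n - i) (Nat.sub_le n i) (by rw [hi i hi', e, sub_sub_cancel])
  · have e' : ω (n - i) = ω n - y := by
      have := hi (n - i) (Nat.sub_le n i)
      rw [Nat.sub_sub_self hi'] at this
      rw [this] at e
      exact (sub_sub_cancel (ω n) (ω (n - i))).symm.trans (by rw [e])
    exact h (n - i) (Nat.sub_le n i) e'

/-! ### The two-ended extension identity -/

/-- **`2 cₙ₊₁ = Σ_ω (extCount ω n + extCount (revWalk n ω) n)`**: every `(n+1)`-step self-avoiding
walk is obtained exactly once by prolonging an `n`-step walk at its end and exactly once by prolonging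
one at its start. [cite: MadrasSlade1993, §1.1, eq. (1.1.1)] -/
theorem two_mul_count_succ_eq_sum (d n : ℕ) :
    2 * count d (n + 1) = ∑ ω ∈ saws d n, (extCount ω n + extCount (revWalk n ω) n) := by
  classical
  rw [Finset.sum_add_distrib, ← count_succ_eq_sum_ext]
  have : ∑ ω ∈ saws d n, extCount (revWalk n ω) n = ∑ ω ∈ saws d n, extCount ω n := by
    rw [← Finset.sum_image (f := fun ω => extCount ω n) (s := saws d n) (g := revWalk n)
      (fun ω₁ h₁ ω₂ h₂ h => revWalk_injOn n (Finset.mem_coe.2 h₁) (Finset.mem_coe.2 h₂) h),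
      image_revWalk_saws]
  rw [this, ← count_succ_eq_sum_ext]
  ring

/-! ### Doubly trapped walks and the reduction -/

open Classical in
/-- The **doubly trapped** `n`-step walks: trapped at the end (`extCount ω n = 0`) and with at most one
free neighbour at the start (`extCount (revWalk n ω) n ≤ 1`). [cite: BDGS2012, §1.3] -/
def doublyTrapped (d n : ℕ) : Finset (ℕ → Site d) :=
  (saws d n).filter fun ω => extCount ω n = 0 ∧ extCount (revWalk n ω) n ≤ 1

/-- Membership in `doublyTrapped`. [cite: BDGS2012, §1.3] -/
theorem mem_doublyTrapped {n : ℕ} {ω : ℕ → Site d} :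
    ω ∈ doublyTrapped d n ↔ ω ∈ saws d n ∧ extCount ω n = 0 ∧ extCount (revWalk n ω) n ≤ 1 := by
  classical
  rw [doublyTrapped, Finset.mem_filter]

open Classical in
/-- Core counting lemma. Let `w` be a weight on `n`-step walks such that every walk `ω'` carrying
weight has `extCount ω' n ≥ w ω' + 2`, or `extCount ω' n ≥ w ω' + 1` together with a start that is
not completely surrounded (`extCount (revWalk n ω') n ≥ 1`). Then the walks that are NOT doubly
trapped, plus the total weight, number at most `cₙ₊₁`. (The reversal of an end-trapped walk with two
free start sites is an untrapped walk with two free end-extensions and a completely surrounded start;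
these reversals pay for the trapped walks outside `T₂`, and the hypothesis on `w` keeps one further
unit of `extCount` free wherever weight is placed.) [cite: BDGS2012, §1.3] -/
theorem card_not_doublyTrapped_add_sum_le_count_succ (n : ℕ) (w : (ℕ → Site d) → ℕ)
    (hw : ∀ ω' ∈ saws d n, w ω' = 0 ∨ w ω' + 2 ≤ extCount ω' n ∨
      (w ω' + 1 ≤ extCount ω' n ∧ 1 ≤ extCount (revWalk n ω') n)) :
    ((saws d n).filter fun ω => ¬ (extCount ω n = 0 ∧ extCount (revWalk n ω) n ≤ 1)).card +
        ∑ ω' ∈ saws d n, w ω' ≤ count d (n + 1) := by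
  classical
  set S := saws d n with hS
  set A := S.filter fun ω => 0 < extCount ω n with hA
  set T₁ := S.filter fun ω => extCount ω n = 0 ∧ 2 ≤ extCount (revWalk n ω) n with hT₁
  set R := T₁.image (revWalk n) with hR
  -- the reversals of `T₁` are untrapped
  have hRA : R ⊆ A := by
    intro ω' hω'
    obtain ⟨ω, hω, rfl⟩ := Finset.mem_image.1 hω'
    obtain ⟨hωS, -, h2⟩ := Finset.mem_filter.1 hω
    exact Finset.mem_filter.2 ⟨revWalk_mem_saws hωS, by omega⟩
  have hRcard : R.card = T₁.card :=
    Finset.card_image_of_injOn fun ω₁ h₁ ω₂ h₂ h =>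
      revWalk_injOn n (Finset.mem_coe.2 (Finset.mem_filter.1 (Finset.mem_coe.1 h₁)).1)
        (Finset.mem_coe.2 (Finset.mem_filter.1 (Finset.mem_coe.1 h₂)).1) h
  -- on `R`, the start is completely surrounded and there are two free end-extensions
  have hRrev : ∀ ω' ∈ R, extCount (revWalk n ω') n = 0 ∧ 2 ≤ extCount ω' n := by
    intro ω' hω'
    obtain ⟨ω, hω, rfl⟩ := Finset.mem_image.1 hω'
    obtain ⟨hωS, h0, h2⟩ := Finset.mem_filter.1 hω
    rw [revWalk_revWalk hωS]
    exact ⟨h0, h2⟩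
  -- weight lives on `A`
  have hwA : ∀ ω' ∈ S, ω' ∉ A → w ω' = 0 := by
    intro ω' hω' hnot
    have h0 : extCount ω' n = 0 := by
      by_contra h
      exact hnot (Finset.mem_filter.2 ⟨hω', Nat.pos_of_ne_zero h⟩)
    rcases hw ω' hω' with h | h | ⟨h, -⟩ <;> omega
  -- pointwise: `extCount ω' n ≥ 1 + [ω' ∈ R] + w ω'` on `A`
  have hpt : ∀ ω' ∈ A, 1 + (if ω' ∈ R then 1 else 0) + w ω' ≤ extCount ω' n := by
    intro ω' hω'
    obtain ⟨hω'S, h1⟩ := Finset.mem_filter.1 hω'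
    by_cases hr : ω' ∈ R <;> simp only [hr, if_true, if_false]
    · obtain ⟨hr0, hr2⟩ := hRrev ω' hr
      rcases hw ω' hω'S with h | h | ⟨-, h⟩ <;> omega
    · rcases hw ω' hω'S with h | h | ⟨h, -⟩ <;> omega
  -- the complement of `T₂` in `S` is `A ∪ T₁` (disjointly)
  have hsplit : (S.filter fun ω => ¬ (extCount ω n = 0 ∧ extCount (revWalk n ω) n ≤ 1)).card =
      A.card + T₁.card := by
    rw [← Finset.card_union_of_disjoint]
    · congr 1
      ext ω
      simp only [Finset.mem_filter, Finset.mem_union, hA, hT₁, not_and, not_le]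
      constructor
      · rintro ⟨hωS, h⟩
        by_cases h0 : extCount ω n = 0
        · exact Or.inr ⟨hωS, h0, h h0⟩
        · exact Or.inl ⟨hωS, Nat.pos_of_ne_zero h0⟩
      · rintro (⟨hωS, h⟩ | ⟨hωS, h0, h2⟩)
        · exact ⟨hωS, fun h0 => absurd h0 (by omega)⟩
        · exact ⟨hωS, fun _ => by omega⟩
    · rw [Finset.disjoint_left]
      intro ω h₁ h₂
      have := (Finset.mem_filter.1 h₁).2
      have := (Finset.mem_filter.1 h₂).2.1
      omega
  -- the weight sums over `A`
  have hwsum : ∑ ω' ∈ S, w ω' = ∑ ω' ∈ A, w ω' :=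
    (Finset.sum_subset (Finset.filter_subset _ _) fun ω' hω' hnot => hwA ω' hω' hnot).symm
  calc (S.filter fun ω => ¬ (extCount ω n = 0 ∧ extCount (revWalk n ω) n ≤ 1)).card +
        ∑ ω' ∈ S, w ω'
      = A.card + R.card + ∑ ω' ∈ A, w ω' := by rw [hsplit, hRcard, hwsum]
    _ = ∑ ω' ∈ A, (1 + (if ω' ∈ R then 1 else 0) + w ω') := by
        rw [Finset.sum_add_distrib, Finset.sum_add_distrib, Finset.sum_const, smul_eq_mul, mul_one,
          Finset.sum_ite_mem, Finset.inter_eq_right.2 hRA, Finset.sum_const, smul_eq_mul, mul_one]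
    _ ≤ ∑ ω' ∈ A, extCount ω' n := Finset.sum_le_sum hpt
    _ ≤ ∑ ω' ∈ S, extCount ω' n :=
        Finset.sum_le_sum_of_subset_of_nonneg (Finset.filter_subset _ _) fun _ _ _ => Nat.zero_le _
    _ = count d (n + 1) := (count_succ_eq_sum_ext d n).symm

/-- `cₙ = #(walks that are not doubly trapped) + #T₂`. [folklore] -/
private theorem count_eq_card_not_add_card_doublyTrapped (d n : ℕ) :
    count d n =
      ((saws d n).filter fun ω => ¬ (extCount ω n = 0 ∧ extCount (revWalk n ω) n ≤ 1)).card +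
        (doublyTrapped d n).card := by
  classical
  rw [← card_saws, doublyTrapped, add_comm, Finset.card_filter_add_card_filter_not]

/-- **`cₙ ≤ cₙ₊₁ + #T₂`.** The number of `n`-step self-avoiding walks exceeds the number of
`(n+1)`-step ones by at most the number of doubly trapped `n`-step walks (trapped at the end and with
at most one free neighbour at the start). In particular O'Brien's inequality can only fail at lengths
where doubly trapped walks exist (on `ℤ²` the first ones have `n = 9`). [cite: BDGS2012, §1.3] -/
theorem count_le_count_succ_add_card_doublyTrapped (d n : ℕ) :
    count d n ≤ count d (n + 1) + (doublyTrapped d n).card := by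
  classical
  have h := card_not_doublyTrapped_add_sum_le_count_succ (d := d) n (fun _ => 0)
    (fun _ _ => Or.inl rfl)
  rw [Finset.sum_const_zero, add_zero] at h
  have := count_eq_card_not_add_card_doublyTrapped d n
  omega

/-- **Reduction of O'Brien's theorem to the doubly trapped walks (injective form).** If the doubly
trapped `n`-step walks can be sent injectively to `n`-step self-avoiding walks that have at least three
free end-extensions, or at least two free end-extensions and a start that is not completely
surrounded, then `cₙ ≤ cₙ₊₁`. [cite: BDGS2012, §1.3] -/
theorem count_le_count_succ_of_doublyTrapped_injOn {n : ℕ} (F : (ℕ → Site d) → (ℕ → Site d))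
    (hF : ∀ ω ∈ doublyTrapped d n, F ω ∈ saws d n ∧
      (3 ≤ extCount (F ω) n ∨ (2 ≤ extCount (F ω) n ∧ 1 ≤ extCount (revWalk n (F ω)) n)))
    (hinj : Set.InjOn F (doublyTrapped d n : Set (ℕ → Site d))) :
    count d n ≤ count d (n + 1) := by
  classical
  set P := (doublyTrapped d n).image F with hP
  have hPS : P ⊆ saws d n := by
    intro ω' hω'
    obtain ⟨ω, hω, rfl⟩ := Finset.mem_image.1 hω'
    exact (hF ω hω).1
  have h := card_not_doublyTrapped_add_sum_le_count_succ (d := d) n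
    (fun ω' => if ω' ∈ P then 1 else 0) (by
      intro ω' hω'
      by_cases hp : ω' ∈ P
      · obtain ⟨ω, hω, rfl⟩ := Finset.mem_image.1 hp
        rcases (hF ω hω).2 with h3 | ⟨h2, h1⟩
        · exact Or.inr (Or.inl (by simp only [hp, if_true]; omega))
        · exact Or.inr (Or.inr ⟨by simp only [hp, if_true]; omega, h1⟩)
      · exact Or.inl (by simp [hp]))
  rw [Finset.sum_ite_mem, Finset.inter_eq_right.2 hPS, Finset.sum_const, smul_eq_mul, mul_one,
    Finset.card_image_of_injOn hinj] at h
  have := count_eq_card_not_add_card_doublyTrapped d n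
  omega

open Classical in
/-- **Reduction of O'Brien's theorem to the doubly trapped walks (fibre form).** It suffices to send
every doubly trapped `n`-step walk to an `n`-step self-avoiding walk `ω'` in such a way that the number
of walks sent to `ω'` is at most `extCount ω' n - 2`, or at most `extCount ω' n - 1` when the start of
`ω'` is not completely surrounded. [cite: BDGS2012, §1.3] -/
theorem count_le_count_succ_of_doublyTrapped_fibers {n : ℕ} (F : (ℕ → Site d) → (ℕ → Site d))
    (hF : ∀ ω ∈ doublyTrapped d n, F ω ∈ saws d n)
    (hfib : ∀ ω' ∈ saws d n,
      ((doublyTrapped d n).filter fun ω => F ω = ω').card = 0 ∨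
      ((doublyTrapped d n).filter fun ω => F ω = ω').card + 2 ≤ extCount ω' n ∨
      (((doublyTrapped d n).filter fun ω => F ω = ω').card + 1 ≤ extCount ω' n ∧
        1 ≤ extCount (revWalk n ω') n)) :
    count d n ≤ count d (n + 1) := by
  classical
  have h := card_not_doublyTrapped_add_sum_le_count_succ (d := d) n
    (fun ω' => ((doublyTrapped d n).filter fun ω => F ω = ω').card) hfib
  have hsum : ∑ ω' ∈ saws d n, ((doublyTrapped d n).filter fun ω => F ω = ω').card =
      (doublyTrapped d n).card :=
    (Finset.card_eq_sum_card_fiberwise fun ω hω => Finset.mem_coe.2 (hF ω (Finset.mem_coe.1 hω))).symm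
  rw [hsum] at h
  have := count_eq_card_not_add_card_doublyTrapped d n
  omega

end Literature.Probability.RandomPlanarGeometry.SAW.Zd
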